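import Mathlib.Topology.Algebra.Module.Cardinality
import Literature.Probability.LatticeModels.CriticalTwoPointLower
import Literature.Probability.LatticeModels.IsingTranslationInvariance
import Literature.Probability.LatticeModels.IsingThermodynamicsProofs
import HarnessLib

/-!
# Long-range order of the free state above `β_c` (Duminil-Copin 2019, Cor. 1.13) — the discharge, after Lebowitz 1977

Topic `Probability/LatticeModels`, namespace `Literature.Probability.LatticeModels`. Sibling proof
file of `SharpnessProofs.lean`: it **discharges the named fact
`Literature.Probability.LatticeModels.twoPointFree_longRangeOrder_of_criticalBeta_lt`**
(`twoPointFree_longRangeOrder_of_criticalBeta_lt_holds`): for the nearest-neighbour Ising model on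
`ℤ^d`, `d ≥ 2`, and every `β > β_c(d) = inf {β ≥ 0 | m*(β) > 0}`, there is `c > 0` with
`c ≤ ⟨σ₀σ_x⟩^∅_{β,0}` for all but finitely many `x` — H. Duminil-Copin, *Lectures on the Ising and
Potts models on the hypercubic lattice* (PIMS–CRM 2017; Springer 2019; arXiv:1707.00520),
**Corollary 1.13** (§1.3.3, p. 12 of the arXiv text): "For any `β > β_c`, (LRO_β) holds true", with
(LRO_β): `lim_{‖x‖→∞} μ^f_β[σ₀σ_x] > 0` (§1.1.2) and `β_c = β_c^{mag}` (§1.1.2, §1.3.2).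

## The proof formalised here

The printed proof of Cor. 1.13 goes through the coupling with the random-cluster model
(`μ^f_β[σ₀σ_x] = φ⁰_{p,2}[0 ↔ x] ≥ φ⁰[0 ↔ ∞]² > 0`: uniqueness of the infinite cluster, Thm. 1.10,
FKG, and `φ⁰ = φ¹` off a countable set of `p`, Thm. 1.12), none of which is in the tree in infinite
volume. We prove the statement instead by the spin-correlation argument of

* J. L. Lebowitz, *Coexistence of phases in Ising ferromagnets*, J. Stat. Phys. **16** (1977)
  463–476 [Lebowitz1977], whose Remark (ii), p. 471, is exactly this statement ("The state at
  `h = 0` obtained with 'zero' … b.c. `μ₀` … is translation invariant and has vanishing odd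
  correlations. Hence `μ₀ = ½(μ₊ + μ₋)`. This implies in particular the existence of 'long-range
  order' in these states for `β > β_c`, i.e., `lim ⟨σᵢσⱼ⟩₀ ≥ [m*(β)]² > 0`"), valid at every `β`
  where the energy is continuous in `β`, i.e. off a countable set (Remark (i), p. 471),

combined with the monotonicity of `β ↦ ⟨σ₀σ_x⟩^∅_β` (GKS II) to cover every `β > β_c`. The steps:

1. **Lebowitz' inequality (7)** (§2, eqs. (4)–(7), p. 466; `gksSum_lebowitzCoexistence`,
   `gksExpect_lebowitzCoexistence`): in Ginibre's duplicated system with couplings `K ≥ |K'|` —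
   here the tree's `gksExpect` framework of `GKSInequalities.lean` — for all `A, B`,
   `⟨σ_B⟩'⟨σ_{A∆B}⟩ - ⟨σ_B⟩⟨σ_{A∆B}⟩' ≤ ⟨σ_A⟩ - ⟨σ_A⟩'`, from `1 - t_A ≥ t_{A∆B} - t_B` for
   `t = ωω''` and GKS I for the twisted couplings `K + K'ω''`. Specialised to the finite-volume Ising
   model, `⟨·⟩ = ⟨·⟩⁺_Λ` dominates every boundary condition (§3, p. 467;
   `isingCorr_lebowitzCoexistence`), and the inequality passes to the states `⟨·⟩⁺_β`, `⟨·⟩^∅_β` on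
   `ℤ^d` (`freeCorr_plusCorr_lebowitzCoexistence`).
2. **Step A — energies and the pressure** (the "general arguments" of the proof of Thm. 2, p. 470,
   in elementary form; `sum_plusCorr_nn_le_sum_freeCorr_nn`): for `0 ≤ β' < β`,
   `∑ᵢ ⟨σ₀σ_{eᵢ}⟩⁺_{β'} ≤ ∑ᵢ ⟨σ₀σ_{eᵢ}⟩^∅_β`. By the Gibbs–Jensen chord inequality
   `(β₂-β₁)⟨-H⟩_{Λ;β₁} ≤ log Z_Λ(β₂) - log Z_Λ(β₁)` (`mul_isingExpect_neg_hamiltonian_le_log_sub`)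
   in the box `B(L+1)` with `+` b.c. at `β'` and with free b.c. at `β`, the decomposition of the
   energy into bond expectations (`isingExpect_neg_hamiltonian_zero_field`), the volume
   (anti)monotonicity and translation invariance of the states (`GKSInequalities`,
   `IsingTranslationInvariance`), the count of edges by direction (`sum_edgesIn_zd`), and the
   existence and boundary-condition independence of the pressure (Friedli–Velenik 2017, Thm. 3.6;
   `hasBoxLimit_pressureIn_holds`):
   `(β-β')∑ᵢ⟨σ₀σ_{eᵢ}⟩⁺_{β'} ≤ ψ(β) - ψ(β') ≤ (β-β')∑ᵢ⟨σ₀σ_{eᵢ}⟩^∅_β`.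
3. **Step C — a good `β` in every interval** (Thm. 2 with Remark (i); `exists_nn_freeCorr_eq_plusCorr`):
   the monotone `β ↦ ∑ᵢ ⟨σ₀σ_{eᵢ}⟩⁺_β` has a continuity point in `(β₁, β₂)` (countably many
   discontinuities, `Monotone.countable_not_continuousAt`, `Set.Countable.dense_compl`), where Step A
   and `⟨·⟩^∅ ≤ ⟨·⟩⁺` give `⟨σ₀σ_{eᵢ}⟩^∅_β = ⟨σ₀σ_{eᵢ}⟩⁺_β` for every `i`.
4. **Step B — propagation** (Corollary (ii) to Lemma 1, p. 466, with the nearest-neighbour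
   generating sets, p. 470; `freeCorr_pair_eq_plusCorr_pair_of_nn`): if the nearest-neighbour
   pair correlations of `⟨·⟩^∅_β` and `⟨·⟩⁺_β` agree and are positive, all pair correlations
   `⟨σ₀σ_x⟩` agree, by induction on `∑ⱼ|xⱼ|` with one application of (7) per lattice step
   (`A = {0,z}`, `B = {z,x}`, `A∆B = {0,x}`).
5. **Assembly** (`twoPointFree_longRangeOrder_of_criticalBeta_lt_holds`): for `β > β_c` choose
   `β_c < β₁ < β₀ < β` with `β₀` as in Step C; `m*(β₁) > 0`
   (`spontaneousMagnetization_pos_of_criticalBeta_lt_holds`, Peierls), so the nearest-neighbour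
   plus correlations at `β₀` are `≥ m*(β₀)² > 0` (GKS II, `spontaneousMagnetization_sq_le_twoPointPlus`)
   and Step B applies; then for `x ≠ 0`,
   `⟨σ₀σ_x⟩^∅_β ≥ ⟨σ₀σ_x⟩^∅_{β₀} = ⟨σ₀σ_x⟩⁺_{β₀} ≥ m*(β₀)² ≥ m*(β₁)² > 0`, and `⟨σ₀σ₀⟩ = 1`.
   The constant `c = m*(β₁)²` works for every `x` (the fact asks for all but finitely many).

Auxiliary lattice bookkeeping ([folklore]), with `eᵢ = Pi.single i 1` and no new definitions:
`edgesIn_zd_eq_biUnion` / `sum_edgesIn_zd` (the edges inside `Λ` are the disjoint union over the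
directions `i` of the edges `{y, y + eᵢ}`, `y, y + eᵢ ∈ Λ`), `box_subset_filter_box_succ`,
`tendsto_card_box_div_card_box_succ` (`|B(L)|/|B(L+1)| → 1`).

## What is not here

No statement is introduced as a named fact and none is changed: everything in this file is proved.
The stronger conclusions of Lebowitz 1977 (Thm. 2: equality of all even correlations of all
translation invariant states at differentiability points of the pressure; Thm. 3; `μ₀ = ½(μ₊+μ₋)`)
are not formalised beyond the pair correlations of `μ^∅` and `μ⁺` needed here; neither is the
differentiability of the pressure itself (Step A uses only chords of `ψ`).

## Mathlib status

No Ising model / Gibbs state / pressure in Mathlib. Anchors: `ConvexOn.map_sum_le` with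
`convexOn_exp` (Jensen), `Real.log_le_log`, `Monotone.countable_not_continuousAt`,
`Set.Countable.dense_compl`, `Dense.exists_mem_open`, `Ioo_mem_nhdsLT`, `le_of_tendsto`,
`le_of_tendsto_of_tendsto`, `Filter.Tendsto.div_atTop`, `Finset.sum_biUnion`, `Finset.sum_map`,
`Sym2.eq_iff`, `Nat.strong_induction_on`; tree anchors `gksSum`, `gksExpect`,
`sum_sum_mul_gksWeight_eq`, `twisted_nonneg_of_abs_le`, `gksSum_spinProduct_nonneg`,
`isingCorr_eq_gksExpect`, `integral_isingMeasure`, `hasBoxLimit_isingCorr_free/plus_holds`,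
`isingCorr_free_box_le_freeCorr`, `plusCorr_le_isingCorr_plus_box`, `freeCorr_shift`,
`plusCorr_shift`, `hasBoxLimit_pressureIn_holds`, `spontaneousMagnetization_sq_le_twoPointPlus`,
`spontaneousMagnetization_pos_of_criticalBeta_lt_holds`, `criticalBeta_pos_holds`.

## References

* H. Duminil-Copin, *Lectures on the Ising and Potts models on the hypercubic lattice*, PIMS–CRM
  Summer School in Probability 2017, Springer (2019), arXiv:1707.00520, §1.3.3, Cor. 1.13
  [DuminilCopin2019].
* J. L. Lebowitz, *Coexistence of phases in Ising ferromagnets*, J. Stat. Phys. 16 (1977) 463–476,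
  §2 (ineq. (7), Lemma 1 and Corollary), §3 (Thm. 2, Remarks (i)–(ii)) [Lebowitz1977].
* S. Friedli, Y. Velenik, *Statistical Mechanics of Lattice Systems*, CUP (2017), Thm. 3.6
  (pressure), §3.6–3.8 (GKS), Thm. 3.17 / Exercise 3.16 (states, translation invariance)
  [FriedliVelenik2017].
-/

noncomputable section

open Finset Filter Topology MeasureTheory
open scoped symmDiff

namespace Literature.Probability.LatticeModels

/-! ### Lebowitz' inequality (7) in Ginibre's duplicated system -/

section LebowitzCoexistence

variable {Λ : Type*} {ι : Type*} [Fintype Λ] [DecidableEq Λ]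
variable (s : Finset ι) (C : ι → Finset Λ)

/-- The sign behind Lebowitz' inequality (7): for `±1`-valued `b, c`,
`1 - bc - b + c = (1 - b)(1 + c) ≥ 0`. [cite: Lebowitz1977, §2, eq. (6), p. 466] -/
theorem one_sub_sub_add_spinProduct_nonneg (A B : Finset Λ) (ω : SpinConfig Λ) :
    0 ≤ 1 - spinProduct A ω - spinProduct B ω + spinProduct (A ∆ B) ω := by
  have hA : spinProduct A ω = spinProduct B ω * spinProduct (A ∆ B) ω := by
    rw [spinProduct_mul_eq_spinProduct_symmDiff, symmDiff_comm A B, symmDiff_symmDiff_cancel_left]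
  rw [hA]
  have key : 1 - spinProduct B ω * spinProduct (A ∆ B) ω - spinProduct B ω + spinProduct (A ∆ B) ω =
      (1 - spinProduct B ω) * (1 + spinProduct (A ∆ B) ω) := by ring
  rw [key]
  refine mul_nonneg (one_sub_spinProduct_nonneg B ω) ?_
  rcases spinProduct_eq_one_or (A ∆ B) ω with h | h <;> rw [h] <;> norm_num

/-- **Lebowitz' inequality (7), unnormalised** (Lebowitz 1977, §2, eqs. (4)–(7): in Ginibre's
duplicated system with couplings `K ≥ |K'|`,
`Z Z' (⟨σ_A⟩ - ⟨σ_A⟩') ≥ Z Z' (⟨σ_B⟩'⟨σ_Aσ_B⟩ - ⟨σ_B⟩⟨σ_Aσ_B⟩')`, from `1 - t_A ≥ t_{A∆B} - t_B`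
for `t = ωω''`). [cite: Lebowitz1977, §2, eq. (7b), p. 466] -/
theorem gksSum_lebowitzCoexistence [DecidableEq ι] {K K' : ι → ℝ} (hK : ∀ i ∈ s, |K' i| ≤ K i)
    (A B : Finset Λ) :
    gksSum s K' C (spinProduct B) * gksSum s K C (spinProduct (A ∆ B)) -
        gksSum s K C (spinProduct B) * gksSum s K' C (spinProduct (A ∆ B)) ≤
      gksSum s K C (spinProduct A) * gksSum s K' C (fun _ => 1) -
        gksSum s K' C (spinProduct A) * gksSum s K C (fun _ => 1) := by
  rw [← sub_nonneg]
  have key : gksSum s K C (spinProduct A) * gksSum s K' C (fun _ => 1) -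
        gksSum s K' C (spinProduct A) * gksSum s K C (fun _ => 1) -
      (gksSum s K' C (spinProduct B) * gksSum s K C (spinProduct (A ∆ B)) -
        gksSum s K C (spinProduct B) * gksSum s K' C (spinProduct (A ∆ B))) =
      ∑ ω, ∑ ω', ((spinProduct A ω - spinProduct A ω') -
          (spinProduct B ω' * spinProduct (A ∆ B) ω - spinProduct B ω * spinProduct (A ∆ B) ω')) *
        (gksWeight s K C ω * gksWeight s K' C ω') := by
    have h1 : gksSum s K C (spinProduct A) * gksSum s K' C (fun _ => 1) =
        ∑ ω, ∑ ω', spinProduct A ω * (gksWeight s K C ω * gksWeight s K' C ω') := by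
      rw [gksSum, gksSum, Finset.sum_mul_sum]
      exact Finset.sum_congr rfl fun ω _ => Finset.sum_congr rfl fun ω' _ => by ring
    have h2 : gksSum s K' C (spinProduct A) * gksSum s K C (fun _ => 1) =
        ∑ ω, ∑ ω', spinProduct A ω' * (gksWeight s K C ω * gksWeight s K' C ω') := by
      rw [gksSum, gksSum, Finset.sum_mul_sum, Finset.sum_comm]
      exact Finset.sum_congr rfl fun ω _ => Finset.sum_congr rfl fun ω' _ => by ring
    have h3 : gksSum s K' C (spinProduct B) * gksSum s K C (spinProduct (A ∆ B)) =
        ∑ ω, ∑ ω', spinProduct B ω' * spinProduct (A ∆ B) ω *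
          (gksWeight s K C ω * gksWeight s K' C ω') := by
      rw [gksSum, gksSum, Finset.sum_mul_sum, Finset.sum_comm]
      exact Finset.sum_congr rfl fun ω _ => Finset.sum_congr rfl fun ω' _ => by ring
    have h4 : gksSum s K C (spinProduct B) * gksSum s K' C (spinProduct (A ∆ B)) =
        ∑ ω, ∑ ω', spinProduct B ω * spinProduct (A ∆ B) ω' *
          (gksWeight s K C ω * gksWeight s K' C ω') := by
      rw [gksSum, gksSum, Finset.sum_mul_sum]
      exact Finset.sum_congr rfl fun ω _ => Finset.sum_congr rfl fun ω' _ => by ring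
    rw [h1, h2, h3, h4]
    simp only [← Finset.sum_sub_distrib]
    refine Finset.sum_congr rfl fun ω _ => Finset.sum_congr rfl fun ω' _ => ?_
    ring
  rw [key, sum_sum_mul_gksWeight_eq]
  refine Finset.sum_nonneg fun ω'' _ => ?_
  have h2 : ∀ ω : SpinConfig Λ, ((spinProduct A ω - spinProduct A (ω * ω'')) -
      (spinProduct B (ω * ω'') * spinProduct (A ∆ B) ω -
        spinProduct B ω * spinProduct (A ∆ B) (ω * ω''))) =
      (1 - spinProduct A ω'' - spinProduct B ω'' + spinProduct (A ∆ B) ω'') * spinProduct A ω := by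
    intro ω
    have hBA : spinProduct B ω * spinProduct (A ∆ B) ω = spinProduct A ω := by
      rw [spinProduct_mul_eq_spinProduct_symmDiff, symmDiff_comm A B, symmDiff_symmDiff_cancel_left]
    rw [spinProduct_mul_cfg, spinProduct_mul_cfg, spinProduct_mul_cfg]
    calc spinProduct A ω - spinProduct A ω * spinProduct A ω'' -
          (spinProduct B ω * spinProduct B ω'' * spinProduct (A ∆ B) ω -
            spinProduct B ω * (spinProduct (A ∆ B) ω * spinProduct (A ∆ B) ω''))
        = spinProduct A ω - spinProduct A ω * spinProduct A ω'' -
          (spinProduct B ω'' * (spinProduct B ω * spinProduct (A ∆ B) ω) -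
            (spinProduct B ω * spinProduct (A ∆ B) ω) * spinProduct (A ∆ B) ω'') := by ring
      _ = _ := by rw [hBA]; ring
  simp_rw [h2, mul_assoc, ← Finset.mul_sum]
  exact mul_nonneg (one_sub_sub_add_spinProduct_nonneg A B ω'')
    (gksSum_spinProduct_nonneg s _ C (twisted_nonneg_of_abs_le s C hK ω'') A)

/-- **Lebowitz' inequality (7b)** (Lebowitz, *Coexistence of phases in Ising ferromagnets*,
J. Stat. Phys. 16 (1977), §2, eq. (7), p. 466): for two spin systems with couplings `K ≥ |K'|` on
the same interaction sets, and all `A, B`,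
`⟨σ_B⟩_{K'} ⟨σ_Aσ_B⟩_K - ⟨σ_B⟩_K ⟨σ_Aσ_B⟩_{K'} ≤ ⟨σ_A⟩_K - ⟨σ_A⟩_{K'}` (`σ_Aσ_B = σ_{A∆B}`). [cite: Lebowitz1977, §2, eq. (7b), p. 466] -/
theorem gksExpect_lebowitzCoexistence [DecidableEq ι] {K K' : ι → ℝ} (hK : ∀ i ∈ s, |K' i| ≤ K i)
    (A B : Finset Λ) :
    gksExpect s K' C (spinProduct B) * gksExpect s K C (spinProduct (A ∆ B)) -
        gksExpect s K C (spinProduct B) * gksExpect s K' C (spinProduct (A ∆ B)) ≤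
      gksExpect s K C (spinProduct A) - gksExpect s K' C (spinProduct A) := by
  have hZ := gksSum_one_pos s K C
  have hZ' := gksSum_one_pos s K' C
  have h := gksSum_lebowitzCoexistence s C hK A B
  simp only [gksExpect]
  rw [div_mul_div_comm, div_mul_div_comm, mul_comm (gksSum s K C fun _ => 1) (gksSum s K' C fun _ => 1),
    ← sub_div, div_sub_div _ _ hZ.ne' hZ'.ne', div_le_div_iff₀ (mul_pos hZ' hZ) (mul_pos hZ hZ')]
  calc (gksSum s K' C (spinProduct B) * gksSum s K C (spinProduct (A ∆ B)) -
          gksSum s K C (spinProduct B) * gksSum s K' C (spinProduct (A ∆ B))) *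
          (gksSum s K C (fun _ => 1) * gksSum s K' C fun _ => 1)
      ≤ (gksSum s K C (spinProduct A) * gksSum s K' C (fun _ => 1) -
          gksSum s K' C (spinProduct A) * gksSum s K C (fun _ => 1)) *
          (gksSum s K C (fun _ => 1) * gksSum s K' C fun _ => 1) :=
        mul_le_mul_of_nonneg_right h (mul_pos hZ hZ').le
    _ = _ := by ring

end LebowitzCoexistence


section IsingFiniteVolume

variable {V : Type*} [DecidableEq V] (G : SimpleGraph V) [G.LocallyFinite]

/-- **Gibbs–Jensen chord inequality for the partition function**: for any volume, field,
boundary condition and `β₁, β₂`,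
`(β₂ - β₁) ⟨-H⟩_{Λ;β₁} ≤ log Z_Λ(β₂) - log Z_Λ(β₁)` (convexity of `β ↦ log Z_Λ(β)`:
`Z(β₂)/Z(β₁) = ⟨e^{(β₂-β₁)(-H)}⟩_{β₁} ≥ e^{(β₂-β₁)⟨-H⟩_{β₁}}` by Jensen's inequality; cf.
Friedli–Velenik 2017, Lemma 3.5 / Exercise 3.2 (convexity of the finite-volume pressure) and
Lebowitz 1977, §3, "general arguments" identifying energies with `∂Ψ/∂β`). [cite: FriedliVelenik2017, §3.2.1, Exercise 3.2] -/
theorem mul_isingExpect_neg_hamiltonian_le_log_sub (Λ : Finset V) (β₁ β₂ h : ℝ)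
    (bc : BoundaryCondition V) :
    (β₂ - β₁) * isingExpect G Λ β₁ h bc (fun σ => -isingHamiltonian G Λ h bc σ) ≤
      Real.log (isingPartitionFunction G Λ β₂ h bc) -
        Real.log (isingPartitionFunction G Λ β₁ h bc) := by
  have hZ₁ := isingPartitionFunction_pos G Λ β₁ h bc
  have hZ₂ := isingPartitionFunction_pos G Λ β₂ h bc
  -- the expectation as a finite Boltzmann average
  have hE : isingExpect G Λ β₁ h bc (fun σ => -isingHamiltonian G Λ h bc σ) =
      ∑ τ : Λ → ℤˣ, (isingWeight G Λ β₁ h bc τ / isingPartitionFunction G Λ β₁ h bc) *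
        (-isingHamiltonian G Λ h bc (glue Λ τ bc)) := by
    have hm : Measurable fun σ => -isingHamiltonian G Λ h bc σ :=
      (measurable_isingHamiltonian G Λ h bc).neg
    rw [isingExpect, integral_isingMeasure G Λ β₁ h bc hm, Finset.sum_div]
    exact Finset.sum_congr rfl fun τ _ => by ring
  -- `Z(β₂)/Z(β₁)` as a Boltzmann average of `exp((β₂-β₁)(-H))`
  have hratio : isingPartitionFunction G Λ β₂ h bc / isingPartitionFunction G Λ β₁ h bc =
      ∑ τ : Λ → ℤˣ, (isingWeight G Λ β₁ h bc τ / isingPartitionFunction G Λ β₁ h bc) *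
        Real.exp ((β₂ - β₁) * (-isingHamiltonian G Λ h bc (glue Λ τ bc))) := by
    rw [show isingPartitionFunction G Λ β₂ h bc = ∑ τ : Λ → ℤˣ, isingWeight G Λ β₂ h bc τ from rfl,
      Finset.sum_div]
    refine Finset.sum_congr rfl fun τ _ => ?_
    rw [isingWeight, isingWeight, div_mul_eq_mul_div, ← Real.exp_add]
    congr 1
    congr 1
    ring
  -- Jensen's inequality for `exp`
  have hJ : Real.exp (∑ τ : Λ → ℤˣ, (isingWeight G Λ β₁ h bc τ / isingPartitionFunction G Λ β₁ h bc) *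
      ((β₂ - β₁) * (-isingHamiltonian G Λ h bc (glue Λ τ bc)))) ≤
      isingPartitionFunction G Λ β₂ h bc / isingPartitionFunction G Λ β₁ h bc := by
    rw [hratio]
    have hw : ∑ τ : Λ → ℤˣ, isingWeight G Λ β₁ h bc τ / isingPartitionFunction G Λ β₁ h bc = 1 := by
      rw [← Finset.sum_div, div_eq_one_iff_eq hZ₁.ne']
      rfl
    have := convexOn_exp.map_sum_le (t := (Finset.univ : Finset (Λ → ℤˣ)))
      (w := fun τ : Λ → ℤˣ => isingWeight G Λ β₁ h bc τ / isingPartitionFunction G Λ β₁ h bc)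
      (p := fun τ => (β₂ - β₁) * (-isingHamiltonian G Λ h bc (glue Λ τ bc)))
      (fun τ _ => (div_pos (isingWeight_pos G Λ β₁ h bc τ) hZ₁).le) hw (fun τ _ => Set.mem_univ _)
    simpa only [smul_eq_mul] using this
  have hlog := Real.log_le_log (Real.exp_pos _) hJ
  rw [Real.log_exp, Real.log_div hZ₂.ne' hZ₁.ne'] at hlog
  calc (β₂ - β₁) * isingExpect G Λ β₁ h bc (fun σ => -isingHamiltonian G Λ h bc σ)
      = ∑ τ : Λ → ℤˣ, (isingWeight G Λ β₁ h bc τ / isingPartitionFunction G Λ β₁ h bc) *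
          ((β₂ - β₁) * (-isingHamiltonian G Λ h bc (glue Λ τ bc))) := by
        rw [hE, Finset.mul_sum]
        exact Finset.sum_congr rfl fun τ _ => by ring
    _ ≤ _ := hlog

/-- At zero field the mean energy is the sum of the bond expectations over the interacting
edges: `⟨-H^{bc}_{Λ;0}⟩ = ∑_{e ∈ ℰ^{bc}_Λ} ⟨σ_e⟩^{bc}_Λ` (Friedli–Velenik 2017, §3.1, eq. (3.2)/(3.6)). [cite: FriedliVelenik2017, §3.1, eqs. (3.2), (3.6)] -/
theorem isingExpect_neg_hamiltonian_zero_field (Λ : Finset V) (β : ℝ) (bc : BoundaryCondition V) :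
    isingExpect G Λ β 0 bc (fun σ => -isingHamiltonian G Λ 0 bc σ) =
      ∑ e ∈ interactionEdges G Λ bc, isingExpect G Λ β 0 bc (fun σ => bondSpin σ e) := by
  have hH : (fun σ => -isingHamiltonian G Λ 0 bc σ) =
      fun σ => ∑ e ∈ interactionEdges G Λ bc, bondSpin σ e := by
    funext σ
    simp [isingHamiltonian]
  have hmeas : Measurable fun σ : SpinConfig V => ∑ e ∈ interactionEdges G Λ bc, bondSpin σ e :=
    Finset.measurable_sum _ fun e _ => measurable_bondSpin e
  rw [hH, isingExpect, integral_isingMeasure G Λ β 0 bc hmeas]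
  simp only [isingExpect]
  have h2 : ∀ e ∈ interactionEdges G Λ bc, ∫ σ, bondSpin σ e ∂isingMeasure G Λ β 0 bc =
      (∑ τ : Λ → ℤˣ, isingWeight G Λ β 0 bc τ * bondSpin (glue Λ τ bc) e) /
        isingPartitionFunction G Λ β 0 bc := fun e _ =>
    integral_isingMeasure G Λ β 0 bc (measurable_bondSpin e)
  rw [Finset.sum_congr rfl h2, ← Finset.sum_div]
  congr 1
  rw [Finset.sum_comm]
  exact Finset.sum_congr rfl fun τ _ => Finset.mul_sum _ _ _

/-- A bond expectation is a pair correlation: `⟨σ_xσ_y⟩ = ⟨σ_{{x,y}}⟩` for `x ≠ y`. [folklore] -/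
theorem isingExpect_bondSpin_mk (Λ : Finset V) (β h : ℝ) (bc : BoundaryCondition V) {x y : V}
    (hxy : x ≠ y) :
    isingExpect G Λ β h bc (fun σ => bondSpin σ s(x, y)) = isingCorr G Λ β h bc {x, y} := by
  rw [isingCorr, ← spinPair_eq_spinProduct hxy]
  rfl

/-- **GKS I for bond observables under the `+` boundary condition**: for `β ≥ 0`, zero field and
an edge `e` of the graph, `⟨σ_e⟩⁺_{Λ;β,0} ≥ 0`, including the boundary edges (where `σ_e` is the
spin at the inner endpoint). (Friedli–Velenik 2017, Thm. 3.20 / §3.8.1, `K_C ≥ 0` for `μ⁺`.) [cite: FriedliVelenik2017, Thm. 3.20, eq. (3.21), p. 109] -/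
theorem isingExpect_plus_bondSpin_nonneg (Λ : Finset V) {β : ℝ} (hβ : 0 ≤ β) {e : Sym2 V}
    (he : e ∈ G.edgeSet) : 0 ≤ isingExpect G Λ β 0 .plus (fun σ => bondSpin σ e) := by
  classical
  rw [isingExpect, integral_isingMeasure G Λ β 0 .plus (measurable_bondSpin e)]
  refine div_nonneg ?_ (isingPartitionFunction_pos G Λ β 0 .plus).le
  induction e using Sym2.ind with
  | _ x y =>
    have hxy : x ≠ y := G.ne_of_adj (by rwa [SimpleGraph.mem_edgeSet] at he)
    have hcfg : ∀ τ : Λ → ℤˣ, bondSpin (glue Λ τ .plus) s(x, y) =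
        spinProduct (isingSupp Λ (.inl s(x, y))) τ := by
      intro τ
      rw [spinProduct_isingSupp_inl τ .plus hxy, bondSpin_mk]
      have hout : ∀ z : V, z ∉ Λ → spinAt z (glue Λ τ .plus) = 1 := fun z hz => by
        rw [spinAt_glue_of_not_mem τ .plus hz]
        simp [spinAt, plus_outside_apply]
      congr 1
      · split_ifs with hx
        · rfl
        · exact hout x hx
      · split_ifs with hy
        · rfl
        · exact hout y hy
    have hsum : ∑ τ : Λ → ℤˣ, isingWeight G Λ β 0 .plus τ * bondSpin (glue Λ τ .plus) s(x, y) =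
        gksSum (isingIdx G Λ) (gksCoupling G Λ β 0 .plus) (isingSupp Λ)
          (spinProduct (isingSupp Λ (.inl s(x, y)))) := by
      rw [gksSum]
      refine Finset.sum_congr rfl fun τ _ => ?_
      rw [isingWeight_eq_gksWeight, hcfg τ, mul_comm]
    rw [hsum]
    exact gksSum_spinProduct_nonneg _ _ _ (gksCoupling_nonneg G hβ le_rfl (Or.inr rfl)) _

end IsingFiniteVolume


variable {d : ℕ}

/-! ### The edges of `ℤ^d` by direction

The unit coordinate vectors are Mathlib's `Pi.single i 1 : Site d`; the edge from `y` in
direction `i` is `s(y, y + Pi.single i 1)`; no auxiliary definitions are introduced. -/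

section LatticeEdges

/-- `eᵢ ≠ 0` in `ℤ^d`. [folklore] -/
theorem unitVec_ne_zero (i : Fin d) : (Pi.single i (1 : ℤ) : Site d) ≠ 0 := by
  intro h
  have := congrFun h i
  simp at this

/-- `eᵢ = eⱼ` only for `i = j`. [folklore] -/
theorem unitVec_injective : Function.Injective (fun i : Fin d => (Pi.single i (1 : ℤ) : Site d)) := by
  intro i j h
  by_contra hij
  have := congrFun h j
  simp only at this
  rw [Pi.single_eq_of_ne (Ne.symm hij), Pi.single_eq_same] at this
  exact zero_ne_one this

/-- `eᵢ + eⱼ ≠ 0`. [folklore] -/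
theorem unitVec_add_unitVec_ne_zero (i j : Fin d) :
    (Pi.single i (1 : ℤ) : Site d) + Pi.single j 1 ≠ 0 := by
  intro h
  have := congrFun h i
  simp only [Pi.add_apply, Pi.single_eq_same, Pi.zero_apply] at this
  by_cases hij : i = j
  · subst hij; simp at this
  · rw [Pi.single_eq_of_ne hij] at this; simp at this

/-- `y ≠ y + eᵢ`. [folklore] -/
theorem ne_add_unitVec (y : Site d) (i : Fin d) : y ≠ y + Pi.single i 1 := by
  intro h
  apply unitVec_ne_zero (d := d) i
  have h2 : y + Pi.single i 1 = y + 0 := by rw [add_zero]; exact h.symm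
  exact add_left_cancel h2

/-- `{y, y + eᵢ}` is an edge of `ℤ^d`. [cite: FriedliVelenik2017, §3.1] -/
theorem dirEdge_mem_edgeSet (i : Fin d) (y : Site d) :
    s(y, y + Pi.single i 1) ∈ (zdGraph d).edgeSet := by
  rw [SimpleGraph.mem_edgeSet, zdGraph_adj_iff]
  exact ⟨i, Or.inl rfl⟩

/-- Every edge of `ℤ^d` is `{y, y + eᵢ}` for some direction `i` and base point `y`. [cite: FriedliVelenik2017, §3.1] -/
theorem exists_eq_dirEdge {e : Sym2 (Site d)} (he : e ∈ (zdGraph d).edgeSet) :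
    ∃ (i : Fin d) (y : Site d), e = s(y, y + Pi.single i 1) := by
  induction e using Sym2.ind with
  | _ a b =>
    rw [SimpleGraph.mem_edgeSet, zdGraph_adj_iff] at he
    obtain ⟨i, h | h⟩ := he
    · exact ⟨i, a, by rw [h]⟩
    · exact ⟨i, b, by rw [h, Sym2.eq_swap]⟩

/-- `y ↦ {y, y + eᵢ}` is injective. [folklore] -/
theorem dirEdge_injective (i : Fin d) :
    Function.Injective fun y : Site d => s(y, y + Pi.single i 1) := by
  intro y y' h
  simp only at h
  rw [Sym2.eq_iff] at h
  rcases h with ⟨h1, -⟩ | ⟨h1, h2⟩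
  · exact h1
  · exfalso
    apply unitVec_add_unitVec_ne_zero (d := d) i i
    have : y' + Pi.single i 1 + Pi.single i 1 = y' := by rw [← h1, h2]
    have h3 : y' + ((Pi.single i 1 : Site d) + Pi.single i 1) = y' + 0 := by
      rw [← add_assoc, this, add_zero]
    exact add_left_cancel h3

/-- Edges in different directions are different. [folklore] -/
theorem dirEdge_ne_of_ne {i j : Fin d} (hij : i ≠ j) (y y' : Site d) :
    s(y, y + Pi.single i 1) ≠ s(y', y' + Pi.single j 1) := by
  intro h
  rw [Sym2.eq_iff] at h
  rcases h with ⟨h1, h2⟩ | ⟨h1, h2⟩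
  · subst h1
    exact hij (unitVec_injective (add_left_cancel h2))
  · apply unitVec_add_unitVec_ne_zero (d := d) j i
    have h3 : y' + ((Pi.single j 1 : Site d) + Pi.single i 1) = y' + 0 := by
      rw [← add_assoc, ← h1, h2, add_zero]
    exact add_left_cancel h3

/-- **Decomposition of the edges inside `Λ ⊂ ℤ^d` by direction**: `ℰ_Λ` is the (disjoint) union
over `i` of the edges `{y, y + eᵢ}` with `y, y + eᵢ ∈ Λ`. [cite: FriedliVelenik2017, §3.1] -/
theorem edgesIn_zd_eq_biUnion (Λ : Finset (Site d)) :
    edgesIn (zdGraph d) Λ = univ.biUnion fun i : Fin d =>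
      (Λ.filter fun y => y + Pi.single i 1 ∈ Λ).image fun y => s(y, y + Pi.single i 1) := by
  ext e
  rw [mem_edgesIn_iff, Finset.mem_biUnion]
  constructor
  · rintro ⟨he, hΛ⟩
    obtain ⟨i, y, rfl⟩ := exists_eq_dirEdge he
    refine ⟨i, mem_univ _, Finset.mem_image.2 ⟨y, Finset.mem_filter.2 ⟨?_, ?_⟩, rfl⟩⟩
    · exact hΛ y (Sym2.mem_mk_left _ _)
    · exact hΛ _ (Sym2.mem_mk_right _ _)
  · rintro ⟨i, -, he⟩
    obtain ⟨y, hy, rfl⟩ := Finset.mem_image.1 he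
    rw [Finset.mem_filter] at hy
    refine ⟨dirEdge_mem_edgeSet i y, fun x hx => ?_⟩
    rw [Sym2.mem_iff] at hx
    rcases hx with rfl | rfl
    · exact hy.1
    · exact hy.2

/-- The direction classes are pairwise disjoint. [folklore] -/
theorem pairwiseDisjoint_dirEdge (Λ : Fin d → Finset (Site d)) :
    ((univ : Finset (Fin d)) : Set (Fin d)).PairwiseDisjoint fun i =>
      (Λ i).image fun y => s(y, y + Pi.single i 1) := by
  intro i _ j _ hij
  rw [Function.onFun, Finset.disjoint_left]
  intro e hei hej
  obtain ⟨y, -, rfl⟩ := Finset.mem_image.1 hei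
  obtain ⟨y', -, h⟩ := Finset.mem_image.1 hej
  exact dirEdge_ne_of_ne hij y y' h.symm

/-- **Sums over the edges inside `Λ ⊂ ℤ^d`, direction by direction.** [folklore] -/
theorem sum_edgesIn_zd (Λ : Finset (Site d)) (g : Sym2 (Site d) → ℝ) :
    ∑ e ∈ edgesIn (zdGraph d) Λ, g e =
      ∑ i : Fin d, ∑ y ∈ Λ.filter (fun y => y + Pi.single i 1 ∈ Λ), g s(y, y + Pi.single i 1) := by
  rw [edgesIn_zd_eq_biUnion, Finset.sum_biUnion (pairwiseDisjoint_dirEdge _)]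
  exact Finset.sum_congr rfl fun i _ => Finset.sum_image fun y _ y' _ h => dirEdge_injective i h

/-- `B(L) ⊆ {y ∈ B(L+1) | y + eᵢ ∈ B(L+1)}`. [folklore] -/
theorem box_subset_filter_box_succ (i : Fin d) (L : ℕ) :
    box d L ⊆ (box d (L + 1)).filter fun y => y + Pi.single i 1 ∈ box d (L + 1) := by
  intro y hy
  rw [Finset.mem_filter]
  rw [mem_box] at hy
  refine ⟨mem_box.2 fun j => ?_, mem_box.2 fun j => ?_⟩
  · have := hy j; push_cast; omega
  · have := hy j
    simp only [Pi.add_apply]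
    by_cases hji : j = i
    · subst hji; rw [Pi.single_eq_same]; push_cast; omega
    · rw [Pi.single_eq_of_ne hji]; push_cast; omega

end LatticeEdges

/-! ### Nearest-neighbour pair correlations and translation invariance -/

section NearestNeighbour

/-- `{y, y + eᵢ}` is the translate by `y` of `{0, eᵢ}`. [folklore] -/
theorem pair_add_eq_map_shift (y v : Site d) :
    ({y, y + v} : Finset (Site d)) = ({0, v} : Finset (Site d)).map (Site.shift y).toEmbedding := by
  rw [Finset.map_insert, Finset.map_singleton]
  simp [add_comm]

/-- Translation invariance of the plus nearest-neighbour correlations: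
`⟨σ_yσ_{y+eᵢ}⟩⁺_β = ⟨σ_0σ_{eᵢ}⟩⁺_β` (`β ≥ 0`; Friedli–Velenik 2017, Thm. 3.17 (2)). [cite: FriedliVelenik2017, Thm. 3.17] -/
theorem plusCorr_pair_shift {β : ℝ} (hβ : 0 ≤ β) (y v : Site d) :
    plusCorr d β 0 {y, y + v} = plusCorr d β 0 {0, v} := by
  rw [pair_add_eq_map_shift, plusCorr_shift d hβ le_rfl]

/-- Translation invariance of the free nearest-neighbour correlations:
`⟨σ_yσ_{y+eᵢ}⟩^∅_β = ⟨σ_0σ_{eᵢ}⟩^∅_β` (`β ≥ 0`; Friedli–Velenik 2017, Exercise 3.16). [cite: FriedliVelenik2017, Exercise 3.16, p. 115] -/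
theorem freeCorr_pair_shift {β : ℝ} (hβ : 0 ≤ β) (y v : Site d) :
    freeCorr d β 0 {y, y + v} = freeCorr d β 0 {0, v} := by
  rw [pair_add_eq_map_shift, freeCorr_shift d hβ le_rfl]

end NearestNeighbour


/-! ### The mean energy in a box: free upper bound, plus lower bound -/

section EnergyBounds

variable {d : ℕ}

/-- **Free mean energy of a box, upper bound**: for `β ≥ 0`,
`⟨-H^∅_{B(L)}⟩^∅_{B(L);β} = ∑_{e ∈ ℰ_{B(L)}} ⟨σ_e⟩^∅_{B(L);β} ≤ |B(L)| ∑ᵢ ⟨σ_0σ_{eᵢ}⟩^∅_β`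
(each finite-volume free bond correlation is at most its infinite-volume value, Friedli–Velenik
2017, Exercise 3.12/3.16, which is translation invariant, Exercise 3.16 with Thm. 3.17 (2); there
are at most `|B(L)|` edges in each direction). [cite: FriedliVelenik2017, Exercise 3.12, p. 112] -/
theorem isingExpect_neg_hamiltonian_free_box_le {β : ℝ} (hβ : 0 ≤ β) (L : ℕ) :
    isingExpect (zdGraph d) (box d L) β 0 .free
        (fun σ => -isingHamiltonian (zdGraph d) (box d L) 0 .free σ) ≤
      #(box d L) * ∑ i, freeCorr d β 0 {0, Pi.single i 1} := by
  rw [isingExpect_neg_hamiltonian_zero_field, interactionEdges_free, sum_edgesIn_zd, Finset.mul_sum]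
  refine Finset.sum_le_sum fun i _ => ?_
  calc ∑ y ∈ (box d L).filter (fun y => y + Pi.single i 1 ∈ box d L),
        isingExpect (zdGraph d) (box d L) β 0 .free (fun σ => bondSpin σ s(y, y + Pi.single i 1))
      ≤ ∑ y ∈ (box d L).filter (fun y => y + Pi.single i 1 ∈ box d L), freeCorr d β 0 {0, Pi.single i 1} := by
        refine Finset.sum_le_sum fun y hy => ?_
        rw [Finset.mem_filter] at hy
        rw [isingExpect_bondSpin_mk _ _ _ _ _ (ne_add_unitVec y i),
          ← freeCorr_pair_shift hβ y (Pi.single i 1)]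
        refine isingCorr_free_box_le_freeCorr hβ le_rfl ?_
        intro z hz
        simp only [Finset.mem_insert, Finset.mem_singleton] at hz
        rcases hz with rfl | rfl
        · exact hy.1
        · exact hy.2
    _ = #((box d L).filter (fun y => y + Pi.single i 1 ∈ box d L)) * freeCorr d β 0 {0, Pi.single i 1} := by
        rw [Finset.sum_const, nsmul_eq_mul]
    _ ≤ #(box d L) * freeCorr d β 0 {0, Pi.single i 1} :=
        mul_le_mul_of_nonneg_right (Nat.cast_le.2 (Finset.card_le_card (Finset.filter_subset _ _)))
          (freeCorr_nonneg hβ le_rfl _)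

/-- **Plus mean energy of a box, lower bound**: for `β ≥ 0`,
`⟨-H⁺_{B(L+1)}⟩⁺_{B(L+1);β} ≥ ∑_{e ∈ ℰ_{B(L+1)}} ⟨σ_e⟩⁺_{B(L+1);β} ≥ |B(L)| ∑ᵢ ⟨σ_0σ_{eᵢ}⟩⁺_β`
(the boundary bonds contribute `⟨σ_x⟩⁺ ≥ 0` by GKS I; each finite-volume plus bond correlation is
at least its infinite-volume value, Friedli–Velenik 2017, Lemma 3.22 / Exercise 3.12, which is
translation invariant, Thm. 3.17 (2); every `y ∈ B(L)` starts an edge of `B(L+1)` in each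
direction). [cite: FriedliVelenik2017, Exercise 3.12, p. 112] -/
theorem le_isingExpect_neg_hamiltonian_plus_box {β : ℝ} (hβ : 0 ≤ β) (L : ℕ) :
    (#(box d L) : ℝ) * ∑ i, plusCorr d β 0 {0, Pi.single i 1} ≤
      isingExpect (zdGraph d) (box d (L + 1)) β 0 .plus
        (fun σ => -isingHamiltonian (zdGraph d) (box d (L + 1)) 0 .plus σ) := by
  have hIE : interactionEdges (zdGraph d) (box d (L + 1)) .plus = edgesTouching (zdGraph d) (box d (L + 1)) :=
    rfl
  rw [isingExpect_neg_hamiltonian_zero_field, hIE, Finset.mul_sum]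
  calc ∑ i, (#(box d L) : ℝ) * plusCorr d β 0 {0, Pi.single i 1}
      = ∑ i, ∑ y ∈ box d L, plusCorr d β 0 {y, y + Pi.single i 1} := by
        refine Finset.sum_congr rfl fun i _ => ?_
        rw [Finset.sum_congr rfl fun y _ => plusCorr_pair_shift hβ y (Pi.single i 1), Finset.sum_const,
          nsmul_eq_mul]
    _ ≤ ∑ i, ∑ y ∈ (box d (L + 1)).filter (fun y => y + Pi.single i 1 ∈ box d (L + 1)), plusCorr d β 0 {y, y + Pi.single i 1} := by
        refine Finset.sum_le_sum fun i _ => ?_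
        exact Finset.sum_le_sum_of_subset_of_nonneg (box_subset_filter_box_succ i L)
          fun y _ _ => plusCorr_nonneg hβ le_rfl _
    _ ≤ ∑ i, ∑ y ∈ (box d (L + 1)).filter (fun y => y + Pi.single i 1 ∈ box d (L + 1)),
          isingExpect (zdGraph d) (box d (L + 1)) β 0 .plus (fun σ => bondSpin σ s(y, y + Pi.single i 1)) := by
        refine Finset.sum_le_sum fun i _ => Finset.sum_le_sum fun y hy => ?_
        rw [Finset.mem_filter] at hy
        rw [isingExpect_bondSpin_mk _ _ _ _ _ (ne_add_unitVec y i)]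
        refine plusCorr_le_isingCorr_plus_box hβ le_rfl ?_
        intro z hz
        simp only [Finset.mem_insert, Finset.mem_singleton] at hz
        rcases hz with rfl | rfl
        · exact hy.1
        · exact hy.2
    _ = ∑ e ∈ edgesIn (zdGraph d) (box d (L + 1)),
          isingExpect (zdGraph d) (box d (L + 1)) β 0 .plus (fun σ => bondSpin σ e) :=
        (sum_edgesIn_zd (box d (L + 1))
          (fun e => isingExpect (zdGraph d) (box d (L + 1)) β 0 .plus (fun σ => bondSpin σ e))).symm
    _ ≤ ∑ e ∈ edgesTouching (zdGraph d) (box d (L + 1)),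
          isingExpect (zdGraph d) (box d (L + 1)) β 0 .plus (fun σ => bondSpin σ e) := by
        refine Finset.sum_le_sum_of_subset_of_nonneg (edgesIn_subset_edgesTouching _) ?_
        intro e he _
        exact isingExpect_plus_bondSpin_nonneg (zdGraph d) _ hβ (mem_edgesTouching_iff.1 he).1

end EnergyBounds

/-! ### Step A: the thermodynamic comparison of nearest-neighbour energies -/

section StepA

variable {d : ℕ}

/-- `|B(L)| / |B(L+1)| → 1`. [folklore] -/
theorem tendsto_card_box_div_card_box_succ (d : ℕ) :
    Tendsto (fun L : ℕ => ((#(box d L) : ℝ) / #(box d (L + 1)))) atTop (𝓝 1) := by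
  have h0 : Tendsto (fun L : ℕ => 2 * (L : ℝ) + 3) atTop atTop :=
    tendsto_atTop_mono (fun L => by linarith [(Nat.cast_nonneg L : (0 : ℝ) ≤ L)])
      tendsto_natCast_atTop_atTop
  have h2 : Tendsto (fun L : ℕ => (2 : ℝ) / (2 * (L : ℝ) + 3)) atTop (𝓝 0) :=
    tendsto_const_nhds.div_atTop h0
  have h3 : Tendsto (fun L : ℕ => (1 - (2 : ℝ) / (2 * (L : ℝ) + 3)) ^ d) atTop (𝓝 ((1 - 0) ^ d)) :=
    (tendsto_const_nhds.sub h2).pow d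
  rw [sub_zero, one_pow] at h3
  refine h3.congr fun L => ?_
  have hL : (2 * (L : ℝ) + 3) ≠ 0 := by positivity
  rw [card_box, card_box]
  push_cast
  rw [show (1 - 2 / (2 * (L : ℝ) + 3)) = (2 * L + 1) / (2 * L + 3) by field_simp; ring, div_pow]
  congr 1
  ring

/-- **Step A (Lebowitz 1977, proof of Thm. 2, "general arguments": the energies of translation
invariant states lie between the one-sided `β`-derivatives of the pressure).** For the
nearest-neighbour Ising model on `ℤ^d` and `0 ≤ β' < β`,

`∑ᵢ ⟨σ_0σ_{eᵢ}⟩⁺_{β'} ≤ ∑ᵢ ⟨σ_0σ_{eᵢ}⟩^∅_{β}`.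

Proof: by the Gibbs–Jensen chord inequality in the box `B(L+1)` with `+` b.c.,
`(β-β')|B(L)| ∑ᵢ ⟨σ_0σ_{eᵢ}⟩⁺_{β'} ≤ (β-β')⟨-H⁺⟩⁺_{β'} ≤ log Z⁺(β) - log Z⁺(β')`, and with free b.c.,
`log Z^∅(β) - log Z^∅(β') ≤ (β-β')⟨-H^∅⟩^∅_{β} ≤ (β-β')|B(L+1)| ∑ᵢ ⟨σ_0σ_{eᵢ}⟩^∅_{β}`; dividing by
`|B(L+1)|` and letting `L → ∞`, both middle terms tend to `ψ(β) - ψ(β')` since the pressure exists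
and does not depend on the boundary condition (Friedli–Velenik 2017, Thm. 3.6). [cite: Lebowitz1977, §3, proof of Thm. 2, p. 470] [cite: FriedliVelenik2017, Thm. 3.6] -/
theorem sum_plusCorr_nn_le_sum_freeCorr_nn {β' β : ℝ} (hβ' : 0 ≤ β') (hlt : β' < β) :
    ∑ i, plusCorr d β' 0 {0, Pi.single i 1} ≤ ∑ i, freeCorr d β 0 {0, Pi.single i 1} := by
  have hβ : 0 ≤ β := hβ'.trans hlt.le
  have hδ : 0 < β - β' := sub_pos.2 hlt
  set P := ∑ i, plusCorr d β' 0 {0, Pi.single i 1} with hP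
  set F := ∑ i, freeCorr d β 0 {0, Pi.single i 1} with hF
  have hN : ∀ L : ℕ, (0 : ℝ) < #(box d (L + 1)) := fun L => by
    exact_mod_cast Finset.card_pos.2 (box_nonempty d (L + 1))
  -- (1) plus boundary condition
  have h1 : ∀ L : ℕ, (β - β') * ((#(box d L) : ℝ) / #(box d (L + 1))) * P ≤
      pressureIn (zdGraph d) (box d (L + 1)) β 0 .plus -
        pressureIn (zdGraph d) (box d (L + 1)) β' 0 .plus := by
    intro L
    have hJ := mul_isingExpect_neg_hamiltonian_le_log_sub (zdGraph d) (box d (L + 1)) β' β 0 .plus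
    have hE := le_isingExpect_neg_hamiltonian_plus_box (d := d) hβ' L
    have hb : (#(box d (L + 1)) : ℝ) ≠ 0 := (hN L).ne'
    rw [pressureIn, pressureIn, ← sub_div, le_div_iff₀ (hN L)]
    calc (β - β') * ((#(box d L) : ℝ) / #(box d (L + 1))) * P * #(box d (L + 1))
        = (β - β') * (#(box d L) * P) := by field_simp
      _ ≤ (β - β') * isingExpect (zdGraph d) (box d (L + 1)) β' 0 .plus
            (fun σ => -isingHamiltonian (zdGraph d) (box d (L + 1)) 0 .plus σ) :=
          mul_le_mul_of_nonneg_left hE hδ.le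
      _ ≤ _ := hJ
  -- (2) free boundary condition
  have h2 : ∀ L : ℕ, pressureIn (zdGraph d) (box d (L + 1)) β 0 .free -
      pressureIn (zdGraph d) (box d (L + 1)) β' 0 .free ≤ (β - β') * F := by
    intro L
    have hJ := mul_isingExpect_neg_hamiltonian_le_log_sub (zdGraph d) (box d (L + 1)) β β' 0 .free
    have hE := isingExpect_neg_hamiltonian_free_box_le (d := d) hβ (L + 1)
    rw [pressureIn, pressureIn, ← sub_div, div_le_iff₀ (hN L)]
    have hE' : (β - β') * isingExpect (zdGraph d) (box d (L + 1)) β 0 .free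
        (fun σ => -isingHamiltonian (zdGraph d) (box d (L + 1)) 0 .free σ) ≤
        (β - β') * (#(box d (L + 1)) * F) := mul_le_mul_of_nonneg_left hE hδ.le
    nlinarith [hJ, hE']
  -- limits
  have hlim : ∀ bc : BoundaryCondition (Site d),
      Tendsto (fun L : ℕ => pressureIn (zdGraph d) (box d (L + 1)) β 0 bc -
        pressureIn (zdGraph d) (box d (L + 1)) β' 0 bc) atTop (𝓝 (pressure d β 0 - pressure d β' 0)) :=
    fun bc => ((hasBoxLimit_pressureIn_holds d β 0 bc).comp (tendsto_add_atTop_nat 1)).sub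
      ((hasBoxLimit_pressureIn_holds d β' 0 bc).comp (tendsto_add_atTop_nat 1))
  have hl : Tendsto (fun L : ℕ => (β - β') * ((#(box d L) : ℝ) / #(box d (L + 1))) * P) atTop
      (𝓝 ((β - β') * 1 * P)) :=
    (tendsto_const_nhds.mul (tendsto_card_box_div_card_box_succ d)).mul tendsto_const_nhds
  rw [mul_one] at hl
  have hA : (β - β') * P ≤ pressure d β 0 - pressure d β' 0 :=
    le_of_tendsto_of_tendsto hl (hlim .plus) (Eventually.of_forall h1)
  have hB : pressure d β 0 - pressure d β' 0 ≤ (β - β') * F := le_of_tendsto' (hlim .free) h2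
  exact le_of_mul_le_mul_left (hA.trans hB) hδ

end StepA


/-! ### Step C: a point of `(β₁, β₂)` where the nearest-neighbour energies of `μ^∅` and `μ⁺` agree -/

section StepC

variable {d : ℕ}

/-- **Lebowitz 1977, Theorem 2 (first step) with Remark (i)**: in every interval `(β₁, β₂)`,
`0 ≤ β₁`, there is `β` with `⟨σ_0σ_{eᵢ}⟩^∅_β = ⟨σ_0σ_{eᵢ}⟩⁺_β` for every direction `i` ("the
continuity of `∂Ψ/∂β` implies that `⟨σ_K⟩₊ = ⟨σ_K⟩_μ` for all `μ ∈ T`"; "using the convexity of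
`Ψ(β,0)` … with the possible exception of a countable number of values of `β`"). Here: the
monotone function `β ↦ ∑ᵢ ⟨σ_0σ_{eᵢ}⟩⁺_β` has a point of continuity `β` in the interval (its
discontinuities are countable), where by Step A `∑ᵢ ⟨σ_0σ_{eᵢ}⟩⁺_β = lim_{β'↑β} ∑ᵢ ⟨σ_0σ_{eᵢ}⟩⁺_{β'}
≤ ∑ᵢ ⟨σ_0σ_{eᵢ}⟩^∅_β`, while `⟨σ_0σ_{eᵢ}⟩^∅_β ≤ ⟨σ_0σ_{eᵢ}⟩⁺_β` termwise. [cite: Lebowitz1977, §3, Thm. 2 and Remark (i), pp. 470–471] -/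
theorem exists_nn_freeCorr_eq_plusCorr {β₁ β₂ : ℝ} (h0 : 0 ≤ β₁) (h12 : β₁ < β₂) :
    ∃ β ∈ Set.Ioo β₁ β₂, ∀ i : Fin d,
      freeCorr d β 0 {0, Pi.single i 1} = plusCorr d β 0 {0, Pi.single i 1} := by
  set Pt : ℝ → ℝ := fun β => ∑ i, plusCorr d (max β 0) 0 {0, Pi.single i 1} with hPt
  have hmono : Monotone Pt := by
    intro a b hab
    simp only [hPt]
    exact Finset.sum_le_sum fun i _ =>
      plusCorr_mono_params (le_max_right a 0) (max_le_max hab le_rfl) le_rfl le_rfl _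
  have hcount : {x | ¬ContinuousAt Pt x}.Countable := hmono.countable_not_continuousAt
  have hdense : Dense {x | ¬ContinuousAt Pt x}ᶜ := hcount.dense_compl ℝ
  obtain ⟨β, hβc, hβI⟩ := hdense.exists_mem_open isOpen_Ioo (Set.nonempty_Ioo.2 h12)
  refine ⟨β, hβI, ?_⟩
  have hβ0 : 0 < β := h0.trans_lt hβI.1
  have hcont : ContinuousAt Pt β := not_not.1 hβc
  have hle : Pt β ≤ ∑ i, freeCorr d β 0 {0, Pi.single i 1} := by
    have hev : ∀ᶠ β' in 𝓝[<] β, Pt β' ≤ ∑ i, freeCorr d β 0 {0, Pi.single i 1} := by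
      filter_upwards [Ioo_mem_nhdsLT hβI.1] with β' hβ'
      have hβ'0 : 0 ≤ β' := h0.trans hβ'.1.le
      simp only [hPt, max_eq_left hβ'0]
      exact sum_plusCorr_nn_le_sum_freeCorr_nn hβ'0 hβ'.2
    exact le_of_tendsto (hcont.tendsto.mono_left nhdsWithin_le_nhds) hev
  have hPβ : Pt β = ∑ i, plusCorr d β 0 {0, Pi.single i 1} := by
    simp only [hPt, max_eq_left hβ0.le]
  rw [hPβ] at hle
  have hterm : ∀ i ∈ (univ : Finset (Fin d)),
      0 ≤ plusCorr d β 0 {0, Pi.single i 1} - freeCorr d β 0 {0, Pi.single i 1} :=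
    fun i _ => sub_nonneg.2 (freeCorr_le_plusCorr hβ0.le le_rfl _)
  have hsum0 : ∑ i, (plusCorr d β 0 {0, Pi.single i 1} - freeCorr d β 0 {0, Pi.single i 1}) = 0 := by
    apply le_antisymm
    · rw [Finset.sum_sub_distrib]; linarith
    · exact Finset.sum_nonneg hterm
  intro i
  have := (Finset.sum_eq_zero_iff_of_nonneg hterm).1 hsum0 i (mem_univ i)
  linarith

end StepC

/-! ### Lebowitz' inequality for the Ising model: finite volume and the states `μ^∅`, `μ⁺` -/

section IsingLebowitz

variable {V : Type*} [DecidableEq V] (G : SimpleGraph V) [G.LocallyFinite]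

/-- **Lebowitz' inequality (7b) for the finite-volume Ising model** (Lebowitz 1977, §3, p. 467:
"`H(σ_Λ; +)` … dominates all other b.c. in the sense of (5)", so (7) applies with `⟨·⟩ = ⟨·⟩⁺_Λ`
and `⟨·⟩' = ⟨·⟩^{bc}_Λ`): for `β, h ≥ 0`, every boundary condition `bc` and `A, B ⊆ Λ`,
`⟨σ_B⟩^{bc}_Λ ⟨σ_{A∆B}⟩⁺_Λ - ⟨σ_B⟩⁺_Λ ⟨σ_{A∆B}⟩^{bc}_Λ ≤ ⟨σ_A⟩⁺_Λ - ⟨σ_A⟩^{bc}_Λ`. [cite: Lebowitz1977, §2 eq. (7b) and §3, pp. 466–468] -/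
theorem isingCorr_lebowitzCoexistence {Λ A B : Finset V} {β h : ℝ} (hβ : 0 ≤ β) (hh : 0 ≤ h)
    (bc : BoundaryCondition V) (hA : A ⊆ Λ) (hB : B ⊆ Λ) :
    isingCorr G Λ β h bc B * isingCorr G Λ β h .plus (A ∆ B) -
        isingCorr G Λ β h .plus B * isingCorr G Λ β h bc (A ∆ B) ≤
      isingCorr G Λ β h .plus A - isingCorr G Λ β h bc A := by
  classical
  have hAB : A ∆ B ⊆ Λ := fun x hx => by
    rw [Finset.mem_symmDiff] at hx
    rcases hx with h | h
    · exact hA h.1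
    · exact hB h.1
  rw [isingCorr_eq_gksExpect G Λ β h bc hB, isingCorr_eq_gksExpect G Λ β h .plus hAB,
    isingCorr_eq_gksExpect G Λ β h .plus hB, isingCorr_eq_gksExpect G Λ β h bc hAB,
    isingCorr_eq_gksExpect G Λ β h .plus hA, isingCorr_eq_gksExpect G Λ β h bc hA, inVol_symmDiff]
  refine gksExpect_lebowitzCoexistence _ _ ?_ _ _
  rintro (e | x) hi
  · rw [isingIdx, Finset.inl_mem_disjSum] at hi
    rw [gksCoupling_plus_inl G β h hi]
    exact abs_gksCoupling_inl_le G hβ h bc e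
  · simp only [gksCoupling]
    rw [abs_of_nonneg (mul_nonneg hβ hh)]

end IsingLebowitz

section IsingLebowitzZd

variable {d : ℕ}

/-- **Lebowitz' inequality (7b) for the free and plus states on `ℤ^d`** (Lebowitz 1977, §2,
Remark after Lemma 2: "(7a)–(7c) … clearly remain valid in the limit `Λ ↗ ℤ^ν`"): for `β, h ≥ 0`
and finite `A, B`,
`⟨σ_B⟩^∅ ⟨σ_{A∆B}⟩⁺ - ⟨σ_B⟩⁺ ⟨σ_{A∆B}⟩^∅ ≤ ⟨σ_A⟩⁺ - ⟨σ_A⟩^∅`. [cite: Lebowitz1977, §2, eq. (7b) and Remark, pp. 466–467] -/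
theorem freeCorr_plusCorr_lebowitzCoexistence {β h : ℝ} (hβ : 0 ≤ β) (hh : 0 ≤ h) (A B : Finset (Site d)) :
    freeCorr d β h B * plusCorr d β h (A ∆ B) - plusCorr d β h B * freeCorr d β h (A ∆ B) ≤
      plusCorr d β h A - freeCorr d β h A := by
  obtain ⟨L₀, hL₀⟩ := exists_forall_subset_box d (A ∪ B)
  have hf := fun C : Finset (Site d) => hasBoxLimit_isingCorr_free_holds (d := d) hβ hh C
  have hp := fun C : Finset (Site d) => hasBoxLimit_isingCorr_plus_holds (d := d) hβ hh C
  refine le_of_tendsto_of_tendsto (((hf B).mul (hp (A ∆ B))).sub ((hp B).mul (hf (A ∆ B))))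
    ((hp A).sub (hf A)) ?_
  filter_upwards [eventually_ge_atTop L₀] with L hL
  have hAB := hL₀ L hL
  exact isingCorr_lebowitzCoexistence (zdGraph d) hβ hh .free (Finset.union_subset_left hAB)
    (Finset.union_subset_right hAB)

end IsingLebowitzZd

/-! ### Step B: propagation of the equality of nearest-neighbour energies to all pairs -/

section StepB

variable {d : ℕ}

/-- A unit step in coordinate `i` towards the hyperplane `xᵢ = 0` decreases `∑ⱼ |xⱼ|` and joins
`x` to its neighbour by an edge of direction `i`. [folklore] -/
theorem exists_unitStep_natAbs_lt {x : Site d} {i : Fin d} (hi : x i ≠ 0) :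
    ∃ z y : Site d, ∑ j, (z j).natAbs < ∑ j, (x j).natAbs ∧
      ({z, x} : Finset (Site d)) = {y, y + Pi.single i 1} ∧ z ≠ x := by
  have hsplit : ∀ w : Site d, ∑ j, (w j).natAbs = (w i).natAbs + ∑ j ∈ univ.erase i, (w j).natAbs :=
    fun w => (Finset.add_sum_erase _ _ (mem_univ i)).symm
  rcases lt_or_gt_of_ne hi with hneg | hpos
  · refine ⟨x + Pi.single i 1, x, ?_, by rw [Finset.pair_comm], (ne_add_unitVec x i).symm⟩
    rw [hsplit (x + Pi.single i 1), hsplit x]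
    have hrest : ∑ j ∈ univ.erase i, ((x + Pi.single i 1 : Site d) j).natAbs = ∑ j ∈ univ.erase i, (x j).natAbs := by
      refine Finset.sum_congr rfl fun j hj => ?_
      rw [Pi.add_apply, Pi.single_eq_of_ne (Finset.ne_of_mem_erase hj), add_zero]
    rw [hrest, Pi.add_apply, Pi.single_eq_same]
    have : (x i + 1).natAbs < (x i).natAbs := by omega
    omega
  · refine ⟨x - Pi.single i 1, x - Pi.single i 1, ?_, by rw [sub_add_cancel], ?_⟩
    · rw [hsplit (x - Pi.single i 1), hsplit x]
      have hrest : ∑ j ∈ univ.erase i, ((x - Pi.single i 1 : Site d) j).natAbs = ∑ j ∈ univ.erase i, (x j).natAbs := by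
        refine Finset.sum_congr rfl fun j hj => ?_
        rw [Pi.sub_apply, Pi.single_eq_of_ne (Finset.ne_of_mem_erase hj), sub_zero]
      rw [hrest, Pi.sub_apply, Pi.single_eq_same]
      have : (x i - 1).natAbs < (x i).natAbs := by omega
      omega
    · intro h
      apply unitVec_ne_zero (d := d) i
      have h2 : x - Pi.single i 1 = x - 0 := by rw [sub_zero]; exact h
      exact sub_right_injective h2

/-- **Lebowitz 1977, Corollary (ii) to Lemma 1 with the nearest-neighbour generating sets**
(p. 466: "`⟨σᵢσⱼ⟩ = ⟨σᵢσⱼ⟩' ≠ 0` for all `i, j` implies `⟨σ_E⟩ = ⟨σ_E⟩'` for `|E|` even", by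
induction through (7b); p. 470: "the `ν` nearest neighbor sets `K_α = {0, e_α}` are generating,
e.g. `(σ₀σ_{e₁})(σ_{e₁}σ_{e₁+e₂}) = σ₀σ_{e₁+e₂}`"), for the states `⟨·⟩ = ⟨·⟩⁺_β` and
`⟨·⟩' = ⟨·⟩^∅_β` on `ℤ^d` (translation invariant, Friedli–Velenik 2017, Thm. 3.17 / Exercise 3.16):
if `⟨σ_0σ_{eᵢ}⟩^∅_β = ⟨σ_0σ_{eᵢ}⟩⁺_β > 0` for every direction `i`, then `⟨σ_0σ_x⟩^∅_β = ⟨σ_0σ_x⟩⁺_β`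
for every `x ≠ 0` (induction on `∑ⱼ |xⱼ|` along a lattice path, one application of (7b) per
step). [cite: Lebowitz1977, §2, Corollary (ii) to Lemma 1, p. 466, and §3, p. 470] -/
theorem freeCorr_pair_eq_plusCorr_pair_of_nn {β : ℝ} (hβ : 0 ≤ β)
    (hnn : ∀ i : Fin d, freeCorr d β 0 {0, Pi.single i 1} = plusCorr d β 0 {0, Pi.single i 1})
    (hpos : ∀ i : Fin d, 0 < plusCorr d β 0 {0, Pi.single i 1}) :
    ∀ x : Site d, x ≠ 0 → freeCorr d β 0 {0, x} = plusCorr d β 0 {0, x} := by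
  suffices h : ∀ n : ℕ, ∀ x : Site d, x ≠ 0 → ∑ j, (x j).natAbs = n →
      freeCorr d β 0 {0, x} = plusCorr d β 0 {0, x} from fun x hx => h _ x hx rfl
  intro n
  induction n using Nat.strong_induction_on with
  | _ n ih =>
  intro x hx hn
  obtain ⟨i, hi⟩ : ∃ i, x i ≠ 0 := by
    by_contra hall
    push Not at hall
    exact hx (funext hall)
  obtain ⟨z, y, hlt, hpair, hzx⟩ := exists_unitStep_natAbs_lt hi
  -- the nearest-neighbour pair `B = {z, x} = {y, y + eᵢ}`: free = plus = pᵢ > 0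
  have hBf : freeCorr d β 0 {z, x} = plusCorr d β 0 {0, Pi.single i 1} := by
    rw [hpair, freeCorr_pair_shift hβ, hnn i]
  have hBp : plusCorr d β 0 {z, x} = plusCorr d β 0 {0, Pi.single i 1} := by
    rw [hpair, plusCorr_pair_shift hβ]
  by_cases hz0 : z = 0
  · -- `{0, x}` is itself a nearest-neighbour pair
    rw [hz0] at hBf hBp
    rw [hBf, hBp]
  · -- induction through Lebowitz' inequality with `A = {0, z}`, `B = {z, x}`, `A ∆ B = {0, x}`
    have hA : freeCorr d β 0 {0, z} = plusCorr d β 0 {0, z} := ih _ (hn ▸ hlt) z hz0 rfl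
    have h0x : (0 : Site d) ≠ x := Ne.symm hx
    have h0z : (0 : Site d) ≠ z := Ne.symm hz0
    have hs1 : ({0, z} : Finset (Site d)) ∆ {z, x} = {0, x} := by
      ext w
      simp only [Finset.mem_symmDiff, Finset.mem_insert, Finset.mem_singleton]
      constructor
      · rintro (⟨h1 | h1, h2⟩ | ⟨h1 | h1, h2⟩)
        · exact Or.inl h1
        · exact absurd (Or.inl h1) h2
        · exact absurd (Or.inr h1) h2
        · exact Or.inr h1
      · rintro (rfl | rfl)
        · exact Or.inl ⟨Or.inl rfl, fun h => h.elim (fun h => h0z h) fun h => h0x h⟩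
        · exact Or.inr ⟨Or.inr rfl, fun h => h.elim (fun h => h0x h.symm) fun h => hzx h.symm⟩
    have hs2 : ({0, z} : Finset (Site d)) ∆ {0, x} = {z, x} := by
      ext w
      simp only [Finset.mem_symmDiff, Finset.mem_insert, Finset.mem_singleton]
      constructor
      · rintro (⟨h1 | h1, h2⟩ | ⟨h1 | h1, h2⟩)
        · exact absurd (Or.inl h1) h2
        · exact Or.inl h1
        · exact absurd (Or.inl h1) h2
        · exact Or.inr h1
      · rintro (rfl | rfl)
        · exact Or.inl ⟨Or.inr rfl, fun h => h.elim (fun h => h0z h.symm) fun h => hzx h⟩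
        · exact Or.inr ⟨Or.inr rfl, fun h => h.elim (fun h => h0x h.symm) fun h => hzx h.symm⟩
    have h1 := freeCorr_plusCorr_lebowitzCoexistence (d := d) hβ le_rfl {0, z} {z, x}
    have h2 := freeCorr_plusCorr_lebowitzCoexistence (d := d) hβ le_rfl {0, z} {0, x}
    rw [hs1, hBf, hBp, hA, sub_self] at h1
    rw [hs2, hBf, hBp, hA, sub_self] at h2
    have hb := hpos i
    nlinarith [h1, h2, hb]

end StepB

/-! ### The discharge: long-range order of the free state above `β_c` -/

section Discharge

variable {d : ℕ}

/-- **Duminil-Copin 2019, Corollary 1.13 (`β > β_c`), proved: long-range order of the free state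
of the nearest-neighbour Ising model on `ℤ^d`, `d ≥ 2`, above `β_c`** — the discharge of the named
fact `twoPointFree_longRangeOrder_of_criticalBeta_lt` of `SharpnessProofs.lean`: for `β > β_c(d)`
there is `c > 0` with `c ≤ ⟨σ₀σ_x⟩^∅_{β,0}` for all (but finitely many) `x`; in fact
`⟨σ₀σ_x⟩^∅_β ≥ m*(β₁)² > 0` for all `x`, any `β₁ ∈ (β_c, β)`. The printed proof of Cor. 1.13
(coupling with the random-cluster model, uniqueness of the infinite cluster, FKG) is replaced by
the spin-correlation proof of Lebowitz, *Coexistence of phases in Ising ferromagnets*, J. Stat.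
Phys. 16 (1977) 463–476, Remark (ii), p. 471 ("`μ₀ = ½(μ₊ + μ₋)` … implies in particular the
existence of long-range order in these states for `β > β_c`, `lim ⟨σᵢσⱼ⟩₀ ≥ [m*(β)]² > 0`"), with
Remark (i) (the exceptional `β` are countable) and the monotonicity of `⟨σ₀σ_x⟩^∅_β` in `β`
(GKS II) to cover every `β > β_c`: pick `β_c < β₁ < β₀ < β` with `⟨σ₀σ_{eᵢ}⟩^∅_{β₀} = ⟨σ₀σ_{eᵢ}⟩⁺_{β₀}`
(Steps A and C), propagate to `⟨σ₀σ_x⟩^∅_{β₀} = ⟨σ₀σ_x⟩⁺_{β₀}` (Step B, Lebowitz' inequality (7)),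
and conclude `⟨σ₀σ_x⟩^∅_β ≥ ⟨σ₀σ_x⟩^∅_{β₀} = ⟨σ₀σ_x⟩⁺_{β₀} ≥ m*(β₀)² ≥ m*(β₁)² > 0` (GKS II in the
plus state, `m*` nondecreasing, `m*(β₁) > 0` for `β₁ > β_c` by Peierls' estimate and the definition
of `β_c`). [cite: DuminilCopin2019, Cor. 1.13, §1.3.3] [cite: Lebowitz1977, §3, Remarks (i)–(ii), p. 471] -/
theorem twoPointFree_longRangeOrder_of_criticalBeta_lt_holds :
    twoPointFree_longRangeOrder_of_criticalBeta_lt (d := d) := by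
  intro hd β hβc
  have hβc0 : 0 < criticalBeta d := criticalBeta_pos_holds hd
  obtain ⟨β₁, h1, h2⟩ : ∃ β₁, criticalBeta d < β₁ ∧ β₁ < β := ⟨(criticalBeta d + β) / 2, by linarith, by linarith⟩
  have hβ₁0 : 0 ≤ β₁ := by linarith
  have hm₁ : 0 < spontaneousMagnetization d β₁ :=
    spontaneousMagnetization_pos_of_criticalBeta_lt_holds hd h1
  obtain ⟨β₀, hβ₀I, hnn⟩ := exists_nn_freeCorr_eq_plusCorr (d := d) hβ₁0 h2
  have hβ₀0 : 0 ≤ β₀ := hβ₁0.trans hβ₀I.1.le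
  have hmono : spontaneousMagnetization d β₁ ≤ spontaneousMagnetization d β₀ :=
    spontaneousMagnetization_mono_holds (Set.mem_Ici.2 hβ₁0) (Set.mem_Ici.2 hβ₀0) hβ₀I.1.le
  have hpos : ∀ i : Fin d, 0 < plusCorr d β₀ 0 {0, Pi.single i 1} := fun i => by
    have h := spontaneousMagnetization_sq_le_twoPointPlus hβ₀0 (unitVec_ne_zero i)
    rw [twoPointPlus_eq_plusCorr β₀ (unitVec_ne_zero i)] at h
    exact lt_of_lt_of_le (pow_pos (hm₁.trans_le hmono) 2) h
  have hall := freeCorr_pair_eq_plusCorr_pair_of_nn hβ₀0 hnn hpos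
  refine ⟨spontaneousMagnetization d β₁ ^ 2, pow_pos hm₁ 2, Eventually.of_forall fun x => ?_⟩
  by_cases hx : x = 0
  · subst hx
    rw [twoPointFree_zero]
    have hle1 := spontaneousMagnetization_le_one_holds (d := d) hβ₁0
    nlinarith
  · calc spontaneousMagnetization d β₁ ^ 2
        ≤ spontaneousMagnetization d β₀ ^ 2 := pow_le_pow_left₀ hm₁.le hmono 2
      _ ≤ twoPointPlus d β₀ x := spontaneousMagnetization_sq_le_twoPointPlus hβ₀0 hx
      _ = plusCorr d β₀ 0 {0, x} := twoPointPlus_eq_plusCorr β₀ hx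
      _ = freeCorr d β₀ 0 {0, x} := (hall x hx).symm
      _ ≤ freeCorr d β 0 {0, x} := freeCorr_mono_params hβ₀0 hβ₀I.2.le le_rfl le_rfl _
      _ = twoPointFree d β x := (twoPointFree_eq_freeCorr β hx).symm

end Discharge


end Literature.Probability.LatticeModels
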